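import Mathlib
import HarnessLib
import Summits.Ventures.LatticeQCDFlow.Exactness.NCMCGeneralSpaceMarkovShift
import Summits.Ventures.LatticeQCDFlow.Exactness.NCMCGeneralSpaceMarkovRun

/-!
# A stationary Markov chain is ergodic as soon as its kernel has no non-trivial almost invariant set — in particular when it is `π`-irreducible or Doeblin-minorised

HONEST FRAMING: exact (Metropolis-corrected) sampling algorithms for lattice gauge theory;
figures of merit are autocorrelation/cost numbers at stated couplings and volumes; no
continuum-physics claim.

Venture `LatticeQCDFlow` (cell pub-lqcd), topic `Exactness`; FANOUT row 13 (`eng-snf`, GEN-16).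
NEW WORK of the cell (a Lean proof of a textbook theorem against Mathlib's Ionescu-Tulcea chain and
Mathlib's Lévy upward theorem `Integrable.tendsto_ae_condExp`), not a published result of ours; no
definition is introduced; nothing is cited as a fact — the statement is classical (e.g.
Hernández-Lerma–Lasserre, *Markov Chains and Invariant Probabilities*, Prop. 2.4.3; Meyn–Tweedie,
*Markov Chains and Stochastic Stability*, Thm 17.1.7 area: "`P_π` is ergodic iff `π` charges no
non-trivial absorbing set"), named only.  Mathlib has `Kernel.IsIrreducible` (Meyn–Tweedie
`φ`-irreducibility) but no theorem connecting kernels to `Ergodic`; this file supplies one.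

## Content (`κ` Markov on `S`, `π` an invariant probability law, `P_π = P_{π,κ}` row 8's chain law,
## `θ` the shift)

* **`ergodic_shift_chain`** — THE CRITERION: if every measurable `B ⊆ S` that is ALMOST INVARIANT
  for `κ` under `π` (`κ(z, Bᶜ) = 0` for `π`-a.e. `z ∈ B` and `κ(z, B) = 0` for `π`-a.e. `z ∉ B`) has
  `π(B) ∈ {0, 1}`, then `P_π` is ergodic for the shift.  Proof: for a shift-invariant path event
  `A`, Lévy's upward theorem along the coordinate filtration gives `P[A | x_{≤n}] → 1_A` a.s.; by
  the conditional Markov property (`traj_apply_of_shift_invariant`) `P[A | x_{≤n}] = h_A(x_n)` with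
  ONE function `h_A(z) = P_{δ_z}(A)`; by stationarity `E|h_A(x_n) − 1_A|` does not depend on `n`,
  hence vanishes: `1_A = h_A(x_0)` a.s.; so `A = {x_0 ∈ B}` a.s. with `B = {h_A = 1}`, and shift
  invariance of `A` makes `B` almost invariant; the hypothesis finishes.
* **`ae_invariant_trivial_of_isIrreducible`** / **`ergodic_shift_chain_of_isIrreducible`** —
  Mathlib's `Kernel.IsIrreducible π κ` (from every state, every `π`-positive set is reached in
  finitely many steps with positive probability) implies the criterion, hence ergodicity.
* **`ae_invariant_trivial_of_minorized`** / **`ergodic_shift_chain_of_minorized`** — a one-step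
  DOEBLIN MINORISATION `κ(z, ·) ≥ ε ν` (`ε ≠ 0`, `ν` any probability law — row 8's certificates
  use `ν = π`) implies the criterion, hence ergodicity.

With `NCMCGeneralSpaceMarkovRun.tendsto_sum_div_ae_chain` this turns every `hErg` hypothesis of the
correlated-starts files into a checkable property of the level sampler; the engine corollary is in
`NCMCGeneralSpaceMarkovErgodicRestart.lean`.  NOT CLAIMED: the converse of the criterion (true,
not needed); aperiodicity / mixing / rates; anything about a concrete sampler's `ε`.
-/

namespace Summit.Ventures.LatticeQCDFlow.Exactness.GeneralNCMC

open MeasureTheory ProbabilityTheory Set Filter Finset Preorder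
open scoped ENNReal Topology

variable {S : Type*} [MeasurableSpace S] (κ : Kernel S S) [IsMarkovKernel κ]
variable {π : Measure S} [IsProbabilityMeasure π]

/-! ## Two-time events of the chain in terms of the kernel -/

/-- `P_π{x_0 ∈ B, x_1 ∈ C} = ∫_B κ(z, C) dπ` (real form). -/
theorem chain_measureReal_eval_zero_one (hπ : Kernel.Invariant κ π) {B C : Set S}
    (hB : MeasurableSet B) (hC : MeasurableSet C) :
    (Kernel.trajMeasure (X := fun _ : ℕ => S) π
        (fun n : ℕ => κ.comap (fun h : (j : ↥(Finset.Iic n)) → S => h ⟨n, Finset.mem_Iic.2 le_rfl⟩)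
          (measurable_pi_apply _))).real ({x | x 0 ∈ B} ∩ {x | x 1 ∈ C}) =
      ∫ z in B, (κ z).real C ∂π := by
  set P := Kernel.trajMeasure (X := fun _ : ℕ => S) π
    (fun n : ℕ => κ.comap (fun h : (j : ↥(Finset.Iic n)) → S => h ⟨n, Finset.mem_Iic.2 le_rfl⟩)
      (measurable_pi_apply _)) with hP
  have hBC : MeasurableSet ({x : ℕ → S | x 0 ∈ B} ∩ {x | x 1 ∈ C}) :=
    (measurable_pi_apply 0 hB).inter (measurable_pi_apply 1 hC)
  have h1 : ∀ y, |B.indicator (1 : S → ℝ) y| ≤ 1 := fun y => by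
    by_cases hy : y ∈ B <;> simp [hy]
  have h2 : ∀ y, |C.indicator (1 : S → ℝ) y| ≤ 1 := fun y => by
    by_cases hy : y ∈ C <;> simp [hy]
  have key := Scoring.chain_tower κ π 0
    (F := fun v : (i : ↥(Finset.Iic 0)) → S => B.indicator (1 : S → ℝ) (v ⟨0, Finset.mem_Iic.2 le_rfl⟩))
    ((measurable_one.indicator hB).comp (measurable_pi_apply _)) (CF := 1) (fun v => h1 _)
    (measurable_one.indicator hC) (Cg := 1) h2
  rw [← hP] at key
  simp only [frestrictLe_apply, Nat.zero_add] at key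
  have hkop : ∀ z, Scoring.kop κ (C.indicator (1 : S → ℝ)) z = (κ z).real C := fun z => by
    unfold Scoring.kop
    exact integral_indicator_one hC
  simp_rw [hkop] at key
  have hind : ∀ x : ℕ → S, B.indicator (1 : S → ℝ) (x 0) * C.indicator (1 : S → ℝ) (x 1) =
      ({x : ℕ → S | x 0 ∈ B} ∩ {x | x 1 ∈ C}).indicator 1 x := by
    intro x
    by_cases hx0 : x 0 ∈ B
    · by_cases hx1 : x 1 ∈ C
      · rw [Set.indicator_of_mem hx0, Set.indicator_of_mem hx1,
          Set.indicator_of_mem (show x ∈ ({x : ℕ → S | x 0 ∈ B} ∩ {x | x 1 ∈ C}) from ⟨hx0, hx1⟩)]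
        simp
      · rw [Set.indicator_of_notMem hx1, Set.indicator_of_notMem (show x ∉ _ from fun h => hx1 h.2)]
        simp
    · rw [Set.indicator_of_notMem hx0, Set.indicator_of_notMem (show x ∉ _ from fun h => hx0 h.1)]
      simp
  simp_rw [hind] at key
  rw [integral_indicator_one hBC] at key
  rw [key, ← integral_indicator hB]
  have hφ : ∀ z, B.indicator (1 : S → ℝ) z * (κ z).real C = B.indicator (fun z => (κ z).real C) z := by
    intro z
    by_cases hz : z ∈ B
    · simp [Set.indicator_of_mem hz]
    · simp [Set.indicator_of_notMem hz]
  simp_rw [hφ]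
  exact integral_comp_eval_zero (chain_map_eval_of_invariant κ hπ 0)
    (((Kernel.measurable_coe κ hC).ennreal_toReal.indicator hB)).aestronglyMeasurable

/-! ## The criterion -/

/-- **ERGODICITY CRITERION FOR STATIONARY MARKOV CHAINS.**  If every measurable set that is almost
invariant for `κ` under `π` is `π`-trivial, the chain law `P_{π,κ}` is ergodic for the shift. -/
theorem ergodic_shift_chain (hπ : Kernel.Invariant κ π)
    (hIrr : ∀ B : Set S, MeasurableSet B → (∀ᵐ z ∂π, z ∈ B → κ z Bᶜ = 0) →
      (∀ᵐ z ∂π, z ∉ B → κ z B = 0) → π B = 0 ∨ π B = 1) :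
    Ergodic (fun (x : ℕ → S) (k : ℕ) => x (k + 1))
      (Kernel.trajMeasure (X := fun _ : ℕ => S) π
        (fun n : ℕ => κ.comap (fun h : (j : ↥(Finset.Iic n)) → S => h ⟨n, Finset.mem_Iic.2 le_rfl⟩)
          (measurable_pi_apply _))) := by
  set P := Kernel.trajMeasure (X := fun _ : ℕ => S) π
    (fun n : ℕ => κ.comap (fun h : (j : ↥(Finset.Iic n)) → S => h ⟨n, Finset.mem_Iic.2 le_rfl⟩)
      (measurable_pi_apply _)) with hP
  have hS : MeasurePreserving (fun (x : ℕ → S) (k : ℕ) => x (k + 1)) P P :=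
    measurePreserving_shift_chain κ hπ
  refine ⟨hS, ⟨fun A hA hinv => ?_⟩⟩
  -- the indicator of `A` and the function `h_A(z) = P_{δ_z}(A)`
  set g : (ℕ → S) → ℝ := A.indicator 1 with hg
  set hR : S → ℝ := fun z => (Kernel.trajMeasure (X := fun _ : ℕ => S) (Measure.dirac z)
    (fun n : ℕ => κ.comap (fun h : (j : ↥(Finset.Iic n)) → S => h ⟨n, Finset.mem_Iic.2 le_rfl⟩)
      (measurable_pi_apply _))).real A with hhR
  have hRm : Measurable hR := (measurable_trajMeasure_dirac κ hA).ennreal_toReal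
  have hgm : Measurable g := measurable_one.indicator hA
  have hR01 : ∀ z, 0 ≤ hR z ∧ hR z ≤ 1 := fun z => ⟨measureReal_nonneg, measureReal_le_one⟩
  have g01 : ∀ x, 0 ≤ g x ∧ g x ≤ 1 := fun x => by
    by_cases hx : x ∈ A
    · simp [hg, Set.indicator_of_mem hx]
    · simp [hg, Set.indicator_of_notMem hx]
  have habs : ∀ z x, |hR z - g x| ≤ 1 := fun z x => by
    rw [abs_sub_le_iff]
    constructor <;> linarith [(hR01 z).1, (hR01 z).2, (g01 x).1, (g01 x).2]
  -- Step 1: Lévy per initial history, through the conditional Markov property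
  have hLevy : ∀ x₀ : (i : ↥(Finset.Iic 0)) → S,
      ∀ᵐ x ∂(Kernel.traj (X := fun _ : ℕ => S)
        (fun n : ℕ => κ.comap (fun h : (j : ↥(Finset.Iic n)) → S => h ⟨n, Finset.mem_Iic.2 le_rfl⟩)
          (measurable_pi_apply _)) 0 x₀),
        Tendsto (fun n => hR (x n)) atTop (𝓝 (g x)) := by
    intro x₀
    set μ := Kernel.traj (X := fun _ : ℕ => S)
      (fun n : ℕ => κ.comap (fun h : (j : ↥(Finset.Iic n)) → S => h ⟨n, Finset.mem_Iic.2 le_rfl⟩)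
        (measurable_pi_apply _)) 0 x₀ with hμ
    have hint : Integrable g μ := (integrable_const (1 : ℝ)).indicator hA
    have hmeas : StronglyMeasurable[⨆ n, (Filtration.piLE (X := fun _ : ℕ => S)) n] g := by
      rw [iSup_piLE]
      exact hgm.stronglyMeasurable
    have hL := hint.tendsto_ae_condExp (ℱ := Filtration.piLE (X := fun _ : ℕ => S)) hmeas
    have hver : ∀ n, (μ[g | (Filtration.piLE (X := fun _ : ℕ => S)) n]) =ᵐ[μ] fun x => hR (x n) := by
      intro n
      refine (Kernel.condExp_traj (Nat.zero_le n) hint).trans (Eventually.of_forall fun x => ?_)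
      show ∫ y, g y ∂(Kernel.traj (X := fun _ : ℕ => S)
        (fun n : ℕ => κ.comap (fun h : (j : ↥(Finset.Iic n)) → S => h ⟨n, Finset.mem_Iic.2 le_rfl⟩)
          (measurable_pi_apply _)) n (frestrictLe n x)) = hR (x n)
      rw [hg, integral_indicator_one hA, hhR]
      simp only
      rw [measureReal_def, measureReal_def, traj_apply_of_shift_invariant κ hA hinv n]
      rfl
    have hall := ae_all_iff.2 hver
    filter_upwards [hL, hall] with x hx hxall
    exact hx.congr fun n => hxall n
  -- Step 2: dominated convergence, per history and then over the initial law
  have hF : ∀ n, Measurable fun x : ℕ → S => ENNReal.ofReal |hR (x n) - g x| := fun n =>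
    ENNReal.measurable_ofReal.comp
      (((hRm.comp (measurable_pi_apply n)).sub hgm).abs)
  have hinner : ∀ x₀ : (i : ↥(Finset.Iic 0)) → S,
      Tendsto (fun n => ∫⁻ x, ENNReal.ofReal |hR (x n) - g x|
        ∂(Kernel.traj (X := fun _ : ℕ => S)
          (fun n : ℕ => κ.comap (fun h : (j : ↥(Finset.Iic n)) → S => h ⟨n, Finset.mem_Iic.2 le_rfl⟩)
            (measurable_pi_apply _)) 0 x₀)) atTop (𝓝 0) := by
    intro x₀
    have h := tendsto_lintegral_of_dominated_convergence (μ := Kernel.traj (X := fun _ : ℕ => S)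
        (fun n : ℕ => κ.comap (fun h : (j : ↥(Finset.Iic n)) → S => h ⟨n, Finset.mem_Iic.2 le_rfl⟩)
          (measurable_pi_apply _)) 0 x₀)
      (F := fun n (x : ℕ → S) => ENNReal.ofReal |hR (x n) - g x|) (f := fun _ => 0)
      (fun _ => 1) hF (fun n => Eventually.of_forall fun x => ENNReal.ofReal_le_one.2 (habs _ _))
      (by simp) ?_
    · simpa using h
    · filter_upwards [hLevy x₀] with x hx
      have h0 : Tendsto (fun n => |hR (x n) - g x|) atTop (𝓝 0) := by
        have := (hx.sub tendsto_const_nhds (b := g x)).abs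
        simpa using this
      simpa using ENNReal.tendsto_ofReal h0
  have hlim : Tendsto (fun n => ∫⁻ x, ENNReal.ofReal |hR (x n) - g x| ∂P) atTop (𝓝 0) := by
    have hbind : ∀ n, ∫⁻ x, ENNReal.ofReal |hR (x n) - g x| ∂P =
        ∫⁻ x₀, ∫⁻ x, ENNReal.ofReal |hR (x n) - g x|
          ∂(Kernel.traj (X := fun _ : ℕ => S)
            (fun n : ℕ => κ.comap (fun h : (j : ↥(Finset.Iic n)) → S => h ⟨n, Finset.mem_Iic.2 le_rfl⟩)
              (measurable_pi_apply _)) 0 x₀)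
          ∂(π.map (MeasurableEquiv.piUnique (fun _ : ↥(Finset.Iic 0) => S)).symm) := by
      intro n
      rw [hP, Kernel.trajMeasure, Measure.lintegral_bind (Kernel.aemeasurable _) (hF n).aemeasurable]
    simp_rw [hbind]
    haveI : IsProbabilityMeasure (π.map (MeasurableEquiv.piUnique (fun _ : ↥(Finset.Iic 0) => S)).symm) :=
      Measure.isProbabilityMeasure_map (MeasurableEquiv.measurable _).aemeasurable
    have h := tendsto_lintegral_of_dominated_convergence
      (μ := π.map (MeasurableEquiv.piUnique (fun _ : ↥(Finset.Iic 0) => S)).symm)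
      (F := fun n x₀ => ∫⁻ x, ENNReal.ofReal |hR (x n) - g x|
          ∂(Kernel.traj (X := fun _ : ℕ => S)
            (fun n : ℕ => κ.comap (fun h : (j : ↥(Finset.Iic n)) → S => h ⟨n, Finset.mem_Iic.2 le_rfl⟩)
              (measurable_pi_apply _)) 0 x₀)) (f := fun _ => 0) (fun _ => 1)
      (fun n => (hF n).lintegral_kernel) (fun n => Eventually.of_forall fun x₀ => ?_) (by simp)
      (Eventually.of_forall hinner)
    · simpa using h
    · calc ∫⁻ x, ENNReal.ofReal |hR (x n) - g x| ∂_ ≤ ∫⁻ _, 1 ∂_ :=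
            lintegral_mono fun x => ENNReal.ofReal_le_one.2 (habs _ _)
        _ = 1 := by simp
  -- Step 3: stationarity makes the sequence constant, hence zero
  have hconst : ∀ n, ∫⁻ x, ENNReal.ofReal |hR (x n) - g x| ∂P =
      ∫⁻ x, ENNReal.ofReal |hR (x 0) - g x| ∂P := by
    intro n
    have hgi : ∀ x, g (((fun (x : ℕ → S) (k : ℕ) => x (k + 1))^[n]) x) = g x := by
      intro x
      have hx : x ∈ A ↔ ((fun (x : ℕ → S) (k : ℕ) => x (k + 1))^[n]) x ∈ A := by
        rw [← Set.mem_preimage, preimage_shift_iterate_eq hinv n]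
      by_cases hxA : x ∈ A
      · rw [hg, Set.indicator_of_mem hxA, Set.indicator_of_mem (hx.1 hxA), Pi.one_apply,
          Pi.one_apply]
      · rw [hg, Set.indicator_of_notMem hxA, Set.indicator_of_notMem (fun h => hxA (hx.2 h))]
    have key := (hS.iterate n).lintegral_comp (hF 0)
    refine Eq.trans ?_ key
    refine lintegral_congr_ae (Eventually.of_forall fun x => ?_)
    simp only
    rw [shift_iterate_apply, Nat.zero_add, hgi]
  have hzero : ∫⁻ x, ENNReal.ofReal |hR (x 0) - g x| ∂P = 0 := by
    have h1 : Tendsto (fun _ : ℕ => ∫⁻ x, ENNReal.ofReal |hR (x 0) - g x| ∂P) atTop (𝓝 0) :=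
      hlim.congr fun n => hconst n
    exact tendsto_nhds_unique tendsto_const_nhds h1
  -- Step 4: `1_A = h_A(x_0)` almost surely
  have hae : ∀ᵐ x ∂P, hR (x 0) = g x := by
    have := (lintegral_eq_zero_iff (hF 0)).1 hzero
    filter_upwards [this] with x hx
    simp only [Pi.zero_apply, ENNReal.ofReal_eq_zero] at hx
    have : |hR (x 0) - g x| = 0 := le_antisymm hx (abs_nonneg _)
    rw [abs_eq_zero, sub_eq_zero] at this
    exact this
  -- Step 5: `A = {x_0 ∈ B}` a.s. with `B = {h_A = 1}`
  set B : Set S := hR ⁻¹' {1} with hBdef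
  have hB : MeasurableSet B := hRm (measurableSet_singleton 1)
  have hiff : ∀ᵐ x ∂P, x ∈ A ↔ x 0 ∈ B := by
    filter_upwards [hae] with x hx
    rw [hBdef, Set.mem_preimage, Set.mem_singleton_iff, hx, hg]
    by_cases hxA : x ∈ A
    · simp [hxA]
    · simp [hxA]
  have hPA : P A = π B := by
    have hAE : A =ᵐ[P] ((fun x : ℕ → S => x 0) ⁻¹' B) := hiff.mono fun x hx => propext hx
    rw [measure_congr hAE, ← Measure.map_apply (measurable_pi_apply 0) hB,
      chain_map_eval_of_invariant κ hπ 0]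
  -- Step 6: `B` is almost invariant
  have hiff1 : ∀ᵐ x ∂P, (x 0 ∈ B ↔ x 1 ∈ B) := by
    have h' : ∀ᵐ x ∂P, ((fun (x : ℕ → S) (k : ℕ) => x (k + 1)) x ∈ A ↔
        ((fun (x : ℕ → S) (k : ℕ) => x (k + 1)) x) 0 ∈ B) :=
      hS.quasiMeasurePreserving.ae (p := fun y : ℕ → S => y ∈ A ↔ y 0 ∈ B) hiff
    filter_upwards [hiff, h'] with x hx hx'
    have hxinv : ((fun (x : ℕ → S) (k : ℕ) => x (k + 1)) x ∈ A ↔ x ∈ A) := Set.ext_iff.1 hinv x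
    exact hx.symm.trans (hxinv.symm.trans hx')
  have hout : ∀ᵐ z ∂π, z ∈ B → κ z Bᶜ = 0 := by
    have h0 : P.real ({x | x 0 ∈ B} ∩ {x | x 1 ∈ Bᶜ}) = 0 := by
      rw [measureReal_eq_zero_iff, measure_eq_zero_iff_ae_notMem]
      filter_upwards [hiff1] with x hx
      rintro ⟨h0, h1⟩
      exact h1 (hx.1 h0)
    rw [chain_measureReal_eval_zero_one κ hπ hB hB.compl] at h0
    have hnn : 0 ≤ᵐ[π.restrict B] fun z => (κ z).real Bᶜ :=
      Eventually.of_forall fun z => measureReal_nonneg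
    have hint : IntegrableOn (fun z => (κ z).real Bᶜ) B π :=
      (Scoring.integrable_of_bounded π (Kernel.measurable_coe κ hB.compl).ennreal_toReal (C := 1)
        fun z => by
          show |(κ z).real Bᶜ| ≤ 1
          rw [abs_of_nonneg measureReal_nonneg]; exact measureReal_le_one).integrableOn
    have := (setIntegral_eq_zero_iff_of_nonneg_ae hnn hint).1 h0
    rw [Filter.EventuallyEq, ae_restrict_iff' hB] at this
    filter_upwards [this] with z hz hzB
    have := hz hzB
    simp only [Pi.zero_apply] at this
    exact (measureReal_eq_zero_iff (measure_ne_top _ _)).1 this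
  have hin : ∀ᵐ z ∂π, z ∉ B → κ z B = 0 := by
    have h0 : P.real ({x | x 0 ∈ Bᶜ} ∩ {x | x 1 ∈ B}) = 0 := by
      rw [measureReal_eq_zero_iff, measure_eq_zero_iff_ae_notMem]
      filter_upwards [hiff1] with x hx
      rintro ⟨h0, h1⟩
      exact h0 (hx.2 h1)
    rw [chain_measureReal_eval_zero_one κ hπ hB.compl hB] at h0
    have hnn : 0 ≤ᵐ[π.restrict Bᶜ] fun z => (κ z).real B :=
      Eventually.of_forall fun z => measureReal_nonneg
    have hint : IntegrableOn (fun z => (κ z).real B) Bᶜ π :=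
      (Scoring.integrable_of_bounded π (Kernel.measurable_coe κ hB).ennreal_toReal (C := 1)
        fun z => by
          show |(κ z).real B| ≤ 1
          rw [abs_of_nonneg measureReal_nonneg]; exact measureReal_le_one).integrableOn
    have := (setIntegral_eq_zero_iff_of_nonneg_ae hnn hint).1 h0
    rw [Filter.EventuallyEq, ae_restrict_iff' hB.compl] at this
    filter_upwards [this] with z hz hzB
    have := hz hzB
    simp only [Pi.zero_apply] at this
    exact (measureReal_eq_zero_iff (measure_ne_top _ _)).1 this
  -- Step 7: conclude
  rw [eventuallyConst_set]
  rcases hIrr B hB hout hin with h0 | h1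
  · right
    exact measure_eq_zero_iff_ae_notMem.1 (hPA.trans h0)
  · left
    exact mem_ae_iff.2 ((prob_compl_eq_zero_iff hA).2 (hPA.trans h1))

end Summit.Ventures.LatticeQCDFlow.Exactness.GeneralNCMC
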